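/-
Copyright (c) 2026 the pub-hodgecm-mathlib formalisation cell (harness21).  Prover seat hodgecm-mathlib-LH4-p09 (g8), req620 Track A «(D-RAM) FOUR-FRAME» squad
(heir dealer LH4-plan (g13) WORD #58 RULING C — (T-G-on) organs).  2026-09-04.
-/
import Summits.HodgeConjecture.HodgeConjecture.Theorems.F0P3cDyRamLabelledKappaGluedStratum        -- ★ p859717 (this seat): ENGINE `finsum_kappaCount_mul_stabiliserWeight_glued_sep_eq`; brings ★ κG1 socket (`sum_kappaCount_glued_rep_level ∕ _subBall`, `finsum_kappaCount_mul_stabiliserWeight_hasAxis_G1`)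
import Summits.HodgeConjecture.HodgeConjecture.Theorems.F0P3cDyRamLabelledGluedLocusCensus        -- ★ p859544 (this seat): `latticeInLevel_diagonal_latt_glued_iff_onLocus`, `v_glueRatio_eq`, `tokenBall_of_le`, `tokenBall_iff_of_add_eq`
import HarnessLib

/-!
# (D-RAM) four-frame, STAGE 1b — (S2b-κS) organ (T-G-on | G1): the LABELLED κ-COUNT on the glued stratum `G1 (2ρ, 2ρ+2t′, 2ρ+2t′)` ON THE GLUE LOCUS
# `|e₂ − e₁| = |e₂ − e₀|·|ϖ|^{2t′}` — the vacuous regime (= ★ κG1's value) and the TUBE's genuine regime in closed form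

Helper brick for dealer LH4-plan (g13) WORD #58 RULING C ((T-G-on) = this seat, 11:20Z): `Theorems/` only, statement-first, ★-only imports, lane
`--supports stmt-HodgeConjecture-24833 --as helper`; it PAYS NO tier-0 row (count-neutral).  ONE shape with LH4-p12 (g7)'s off-locus one-token socket
`finsum_kappaCount_mul_stabiliserWeight_stratum_G1_sep_latticeInLevel_of_ne` (`(k) (hk) (hloc)` for `(hne)`).

WHERE THE LOCUS LIVES.  For the token of record `e = ((α−1)², (β−1)², 0)` the glue locus on `G1(ρ, s = 2t′)` is `2n₁ = 2n₂ + 2t′`, i.e. `n₁ = n₂ + t′` — never the glue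
foot `n₁ = n₂ + 2t′`, so it sits in the TUBE (`2ρ + 2t′ ≤ n₁`, `2ρ ≤ n₂`) or in an empty regime; with `k = 2n₂ ≥ 4ρ` the token ball is VACUOUS as soon as `ℓ ≤ 2ρ`.
* §1 `latticeInLevel_of_mem_stratum_G1_of_vacuous` + HEAD **`finsum_kappaCount_mul_stabiliserWeight_stratum_G1_sep_eq_of_vacuous`** — on the locus with the outer
  reads and `ℓ + 2ρ ≤ k` the label cuts nothing: the label-cut κ-sum IS ★ κG1 `finsum_kappaCount_mul_stabiliserWeight_hasAxis_G1` (value and `f₀` binder verbatim), any regime.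
* §2 HEAD **`finsum_kappaCount_mul_stabiliserWeight_stratum_G1_sep_onLocus_tube_of_witness`** — TUBE, genuine `k < ℓ + 2ρ`, `E = ℓ + 2ρ + 2t′ − k` (`2t′ < E ≤ ρ + 2t′` by
  the reads), a fixed witness `f₀` with `|f₀ + g_e| ≤ |ϖ|^E`: by the ENGINE (every representative stable on the tube) and ★ `sum_kappaCount_glued_rep_subBall` over the
  token ball recentred at `f₀`: `[outer] · (ω(−1)ω(1+f₀)·[2d ≤ E+1], ω(−1)ω(f₀)ω(1+f₀)·[2d+2t′ ≤ E+1], ω(f₀)·[2d+2t′ ≤ E+1])ᵢ · q^{2ρ+2t′−⌈E∕2⌉}`;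
  **`…_onLocus_of_no_witness`** = `0` (any regime).
The glue-foot genuine regime (two balls; relevant only for the second token `D₁` of the level trunk) is the next file.

HONEST LABEL: helper organs for a HYPOTHESIS (★ p859650 ∕ p01's two-token `hTrunk`); STAGE-1b tier-0 rows T₊∕T₋∕regular and the six ED. 5 stubs stay OPEN; HC_CM is
proved only modulo the 7 printed citations (2 remaining named inputs: hLiu418 = `stmt-HodgeConjecture-24832`, h413 = `stmt-HodgeConjecture-24833`) until rung 0 closes.

## References
* [Kottwitz1986BaseChangeUnits] R. E. Kottwitz, *Base change for unit elements of Hecke algebras*, Compositio Math. 60 (1986), §1 pp. 240–241 (κ-orbital integrals of units as signed lattice counts modulo the torus).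
* [LanglandsShelstad1987] R. P. Langlands, D. Shelstad, *On the definition of transfer factors*, Math. Ann. 278 (1987), §3 (κ as a character).
* [Rogawski1990] J. D. Rogawski, *Automorphic Representations of Unitary Groups in Three Variables*, Ann. of Math. Stud. 123 (1990), §4.9 Prop. 4.9.1 (a) p. 55.
* [Serre1979] J.-P. Serre, *Local Fields*, GTM 67 (1979), Ch. V §3 Prop. 5, Cor. 3 (norm residue symbol behind `ω`).
-/

set_option autoImplicit false

noncomputable section

namespace Summit.HodgeConjecture.HodgeConjecture.Cruxes.H413.F0P3cDyRamLabelledKappaGluedLocus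

open Matrix WithZero
open Literature.NumberTheory.Automorphic Literature.NumberTheory.Automorphic.HermitianLattice
open Literature.NumberTheory.Automorphic.UnitaryLatticeTree Literature.NumberTheory.Automorphic.UnitaryThreeFourFrame
open Literature.NumberTheory.LocalFields.WildQuadraticDatum
open Summit.HodgeConjecture.HodgeConjecture.Cruxes.H413.F0P3cDyRamDiagonalTorusDefs
open Summit.HodgeConjecture.HodgeConjecture.Cruxes.H413.F0P3cDyRamDiagonalStrataDefs
open Summit.HodgeConjecture.HodgeConjecture.Cruxes.H413.F0P3cDyRamDiagonalKappaCountDefs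
open Summit.HodgeConjecture.HodgeConjecture.Cruxes.H413.F0P3cDyRamDiagonalKappaGluedDecomposition (mapGL_latt_glued_rep_of_depths)
open Summit.HodgeConjecture.HodgeConjecture.Cruxes.H413.F0P3cDyRamDiagonalKappaGluedSocket (sum_kappaCount_glued_rep_subBall finsum_kappaCount_mul_stabiliserWeight_hasAxis_G1)
open Summit.HodgeConjecture.HodgeConjecture.Cruxes.H413.F0P3cDyRamDiagonalKappaGluedClassSums (level_of_mem_subBall)
open Summit.HodgeConjecture.HodgeConjecture.Cruxes.H413.F0P3cDyRamDiagonalGluedStabiliserIndex (ne_zero_and_v_lt_one_of_v_eq_exp)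
open Summit.HodgeConjecture.HodgeConjecture.Cruxes.H413.F0P3cDyRamDiagonalGluedStabiliserMembership (pow_mul_le_pow_add_iff)
open Summit.HodgeConjecture.HodgeConjecture.Cruxes.H413.F0P3cDyRamDiagonalGluedStratum (stratum_G1_eq)
open Summit.HodgeConjecture.HodgeConjecture.Cruxes.H413.F0P3cDyRamDiagonalGluedTorusOrbits (exists_gl_coe_eq_glued)
open Summit.HodgeConjecture.HodgeConjecture.Cruxes.H413.F0P3cDyRamDiagonalGluedClassRepresentatives (exists_fixed_class_representatives)
open Summit.HodgeConjecture.HodgeConjecture.Cruxes.H413.F0P3cDyRamFourFrameCensusDefs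
open Summit.HodgeConjecture.HodgeConjecture.Cruxes.H413.F0P3cDyRamDiagonalOrbitCountLabelled (latticeInLevel_mapGL_diagGLUnits_iff)
open Summit.HodgeConjecture.HodgeConjecture.Cruxes.H413.F0P3cDyRamLabelledSplitStrata (finsum_mem_sep_eq_ite_of_forall_iff)
open Summit.HodgeConjecture.HodgeConjecture.Cruxes.H413.F0P3cDyRamLabelledGluedLocusCensus (latticeInLevel_diagonal_latt_glued_iff_onLocus v_glueRatio_eq tokenBall_of_le tokenBall_iff_of_add_eq)
open Summit.HodgeConjecture.HodgeConjecture.Cruxes.H413.F0P3cDyRamLabelledKappaGluedStratum (finsum_kappaCount_mul_stabiliserWeight_glued_sep_eq)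
open scoped Valued WithZero Matrix MatrixGroups

variable {K : Type} [Field K] [Valued K ℤᵐ⁰] [CompleteSpace K] [Fintype 𝓀[K]] {σ : K →+* K} {ϖ : K} {d t : ℕ} {α β : K} {N₀ n₁ n₂ n₃ : ℕ}
  {T : GL (Fin 3) K}

/-! ## §1  The vacuous regime: the label cuts nothing -/

omit [CompleteSpace K] [Fintype 𝓀[K]] in
/-- **IN THE VACUOUS REGIME THE TOKEN HOLDS ON THE WHOLE G1 STRATUM**: on the locus `v(e₂−e₀) = k`, `v(e₂−e₁) = k + 2t′` with the outer reads `[|eᵢ| ≤ |ϖ|^ℓ]`,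
`ℓ + ρ ≤ k` and `ℓ + 2ρ ≤ k`, every member of `G1 (2ρ, 2ρ+2t′, 2ρ+2t′)` carries the token (★ F1 normal form, ★ p859544 read, `tokenBall_of_le`).
[cite: Kottwitz1986BaseChangeUnits, §1 pp. 240–241] -/
theorem latticeInLevel_of_mem_stratum_G1_of_vacuous (hD : IsRamifiedQuadraticDatum σ ϖ d t) (T : GL (Fin 3) K) (ρ t' : ℕ) (hρ : 1 ≤ ρ) (ht' : 1 ≤ t')
    (ℓ k : ℕ) (e : Fin 3 → K) (hk : Valued.v (e 2 - e 0) = Valued.v ϖ ^ k) (hloc : Valued.v (e 2 - e 1) = Valued.v ϖ ^ (k + 2 * t'))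
    (hout : (Valued.v (e 0) ≤ Valued.v ϖ ^ ℓ ∧ Valued.v (e 1) ≤ Valued.v ϖ ^ ℓ ∧ Valued.v (e 2) ≤ Valued.v ϖ ^ ℓ) ∧ ℓ + ρ ≤ k) (hvac : ℓ + 2 * ρ ≤ k)
    {M : Submodule 𝒪[K] (Fin 3 → K)} (hM : M ∈ stratum σ ϖ T ![2 * ρ, 2 * ρ + 2 * t', 2 * ρ + 2 * t']) : LatticeInLevel ϖ ℓ (Matrix.diagonal e) M := by
  have hvσ : ∀ a, Valued.v (σ a) = Valued.v a := hD.2.1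
  have hϖ : Valued.v ϖ = exp (-1 : ℤ) := hD.2.2.1
  have hfix : ∀ x : K, σ x = x → x ≠ 0 → ∃ n : ℤ, Valued.v x = exp (2 * n) := hD.2.2.2.1
  obtain ⟨hϖ0, hϖ1⟩ := ne_zero_and_v_lt_one_of_v_eq_exp hϖ
  rw [stratum_G1_eq hvσ hfix hϖ T hρ (by omega : 1 ≤ 2 * t')] at hM
  obtain ⟨x, ζ, y'', hx, hζ, hy, rfl, -, -⟩ := hM
  have hκ : Valued.v (y'' / (x * ζ)) = Valued.v ϖ ^ (2 * t') := by rw [map_div₀, map_mul, hx, hζ, mul_one, div_one, hy]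
  exact (latticeInLevel_diagonal_latt_glued_iff_onLocus hϖ ℓ ρ t' k ht' e hk hloc hx hζ y'').2
    ⟨hout, tokenBall_of_le hϖ1.le hvac hκ (v_glueRatio_eq hϖ0 hk hloc)⟩

/-- **HEAD — IN THE VACUOUS REGIME THE LABELLED κ-WEIGHTED G1 SUM IS ★ κG1's UNLABELLED VALUE** (any regime of the datum; `f₀` ∕ `hglue` binders verbatim from ★
`finsum_kappaCount_mul_stabiliserWeight_hasAxis_G1`, `s = 2t′`). [cite: Kottwitz1986BaseChangeUnits, §1 pp. 240–241] [cite: LanglandsShelstad1987, §3]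
[cite: Rogawski1990, §4.9 Prop. 4.9.1 (a) p. 55] -/
theorem finsum_kappaCount_mul_stabiliserWeight_stratum_G1_sep_eq_of_vacuous (hD : IsRamifiedQuadraticDatum σ ϖ d t) (h2 : Valued.v (2 : K) < 1)
    (hE : IsElementDatum σ ϖ N₀ α β n₁ n₂ n₃) (hN₀ : d ≤ N₀) (hT : (T : Matrix (Fin 3) (Fin 3) K) = Matrix.diagonal ![α, β, 1])
    (ρ t' : ℕ) (hρ : 1 ≤ ρ) (ht' : 1 ≤ t') (i : Fin 3) (f₀ : K) (hf₀ : σ f₀ = f₀)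
    (hglue : 2 ∣ 2 * t' → n₂ = n₃ → n₁ = n₂ + 2 * t' → n₂ < 2 * ρ → 2 * ρ - n₂ ≤ n₂ - d + 1 →
      Valued.v (f₀ + (β - 1) / (α - 1)) ≤ Valued.v ϖ ^ (2 * ρ + 2 * t' - n₂))
    (ℓ k : ℕ) (e : Fin 3 → K) (hk : Valued.v (e 2 - e 0) = Valued.v ϖ ^ k) (hloc : Valued.v (e 2 - e 1) = Valued.v ϖ ^ (k + 2 * t'))
    (hout : (Valued.v (e 0) ≤ Valued.v ϖ ^ ℓ ∧ Valued.v (e 1) ≤ Valued.v ϖ ^ ℓ ∧ Valued.v (e 2) ≤ Valued.v ϖ ^ ℓ) ∧ ℓ + ρ ≤ k) (hvac : ℓ + 2 * ρ ≤ k) :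
    ∑ᶠ M ∈ {M | M ∈ stratum σ ϖ T ![2 * ρ, 2 * ρ + 2 * t', 2 * ρ + 2 * t'] ∧ LatticeInLevel ϖ ℓ (Matrix.diagonal e) M},
        (kappaCount σ ϖ 0 i M : ℚ) * stabiliserWeight σ M =
      (if 2 ∣ 2 * t' ∧ 2 * ρ ≤ min n₂ n₃ ∧ 2 * ρ + 2 * t' ≤ n₁ then
          (![(normSign σ (-1 : K) : ℚ) * (Fintype.card 𝓀[K] : ℚ) ^ (2 * ρ + 2 * t' / 2 - 1) *
              ((if 2 * d ≤ 2 * t' then (Fintype.card 𝓀[K] : ℚ) - 1 else 0) - (if 2 * t' + 2 = 2 * d then 1 else 0)), 0, 0] : Fin 3 → ℚ) i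
        else 0) +
      (if 2 ∣ 2 * t' ∧ n₂ = n₃ ∧ n₁ = n₂ + 2 * t' ∧ n₂ < 2 * ρ ∧ 2 * ρ - n₂ ≤ n₂ - d + 1 then
          (![if 2 * d ≤ 2 * t' + 2 * ((2 * ρ - n₂ + 1) / 2) then (normSign σ (-1 : K) : ℚ) * normSign σ (1 + f₀) else 0,
             if d ≤ (2 * ρ - n₂ + 1) / 2 then (normSign σ (-1 : K) : ℚ) * normSign σ f₀ * normSign σ (1 + f₀) else 0,
             if d ≤ (2 * ρ - n₂ + 1) / 2 then (normSign σ f₀ : ℚ) else 0] : Fin 3 → ℚ) i *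
            (Fintype.card 𝓀[K] : ℚ) ^ (2 * ρ + 2 * t' / 2 - (2 * ρ - n₂ + 1) / 2)
        else 0) := by
  classical
  rw [finsum_mem_sep_eq_ite_of_forall_iff (stratum σ ϖ T ![2 * ρ, 2 * ρ + 2 * t', 2 * ρ + 2 * t']) _ True
      (fun M hM => iff_true_intro (latticeInLevel_of_mem_stratum_G1_of_vacuous hD T ρ t' hρ ht' ℓ k e hk hloc hout hvac hM)) _, if_pos trivial,
    finsum_kappaCount_mul_stabiliserWeight_hasAxis_G1 hD h2 hE hN₀ hT ρ (2 * t') hρ (by omega) i f₀ hf₀ hglue]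

/-! ## §2  The tube, genuine regime -/

open Classical in
/-- **HEAD — LABELLED κ-WEIGHTED G1 SUM, TUBE, GENUINE REGIME, WITH A FIXED WITNESS** (`2ρ + 2t′ ≤ n₁`, `2ρ ≤ n₂`; `v(e₂−e₀) = k < ℓ + 2ρ`,
`v(e₂−e₁) = k + 2t′`, `E = ℓ + 2ρ + 2t′ − k`; `σ f₀ = f₀`, `|f₀ + g_e| ≤ |ϖ|^E`):
`Σᶠ_{M ∈ G1, diag(e)M ⊆ ϖ^ℓM} κᵢ(M)·w(M) = [outer] · (ω(−1)ω(1+f₀)·[2d ≤ E+1], ω(−1)ω(f₀)ω(1+f₀)·[2d+2t′ ≤ E+1], ω(f₀)·[2d+2t′ ≤ E+1])ᵢ · q^{2ρ+2t′−⌈E∕2⌉}` —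
ENGINE (★ p859717) with every representative stable on the tube (★ `mapGL_latt_glued_rep_of_depths`), the token at `V(1,1,g)` read by ★ p859544 (`κ = g`), and ★
`sum_kappaCount_glued_rep_subBall` over the token ball recentred at the fixed witness. [cite: Kottwitz1986BaseChangeUnits, §1 pp. 240–241] [cite: LanglandsShelstad1987, §3]
[cite: Serre1979, Ch. V §3 Prop. 5, Cor. 3] [cite: Rogawski1990, §4.9 Prop. 4.9.1 (a) p. 55] -/
theorem finsum_kappaCount_mul_stabiliserWeight_stratum_G1_sep_onLocus_tube_of_witness (hD : IsRamifiedQuadraticDatum σ ϖ d t) (h2 : Valued.v (2 : K) < 1)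
    (hE : IsElementDatum σ ϖ N₀ α β n₁ n₂ n₃) (hT : (T : Matrix (Fin 3) (Fin 3) K) = Matrix.diagonal ![α, β, 1])
    (ρ t' : ℕ) (hρ : 1 ≤ ρ) (ht' : 1 ≤ t') (htube : 2 * ρ + 2 * t' ≤ n₁ ∧ 2 * ρ ≤ n₂) (i : Fin 3) (ℓ k : ℕ) (e : Fin 3 → K)
    (hk : Valued.v (e 2 - e 0) = Valued.v ϖ ^ k) (hloc : Valued.v (e 2 - e 1) = Valued.v ϖ ^ (k + 2 * t')) (hgen : k < ℓ + 2 * ρ)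
    {f₀ : K} (hσf₀ : σ f₀ = f₀) (hf₀ : Valued.v (f₀ + (e 2 - e 1) / (e 2 - e 0)) ≤ Valued.v ϖ ^ (ℓ + 2 * ρ + 2 * t' - k)) :
    ∑ᶠ M ∈ {M | M ∈ stratum σ ϖ T ![2 * ρ, 2 * ρ + 2 * t', 2 * ρ + 2 * t'] ∧ LatticeInLevel ϖ ℓ (Matrix.diagonal e) M},
        (kappaCount σ ϖ 0 i M : ℚ) * stabiliserWeight σ M =
      if (Valued.v (e 0) ≤ Valued.v ϖ ^ ℓ ∧ Valued.v (e 1) ≤ Valued.v ϖ ^ ℓ ∧ Valued.v (e 2) ≤ Valued.v ϖ ^ ℓ) ∧ ℓ + ρ ≤ k then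
        (![if 2 * d ≤ ℓ + 2 * ρ + 2 * t' - k + 1 then (normSign σ (-1 : K) : ℚ) * normSign σ (1 + f₀) else 0,
           if 2 * d + 2 * t' ≤ ℓ + 2 * ρ + 2 * t' - k + 1 then (normSign σ (-1 : K) : ℚ) * normSign σ f₀ * normSign σ (1 + f₀) else 0,
           if 2 * d + 2 * t' ≤ ℓ + 2 * ρ + 2 * t' - k + 1 then (normSign σ f₀ : ℚ) else 0] : Fin 3 → ℚ) i *
          (Fintype.card 𝓀[K] : ℚ) ^ (2 * ρ + 2 * t' - (ℓ + 2 * ρ + 2 * t' - k + 1) / 2)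
      else 0 := by
  classical
  have hTr := trace_bound_of_isRamifiedQuadraticDatum hD h2
  obtain ⟨hσ, hvσ, hϖ, hfix, hd, -, -⟩ := id hD
  obtain ⟨hαn, hβn, -, -, -, h₁, h₂, h₃, -, -, -⟩ := id hE
  have hα := UnitaryThreeFourFrame.v_eq_one_of_mul_map_eq_one hvσ hαn
  have hβ := UnitaryThreeFourFrame.v_eq_one_of_mul_map_eq_one hvσ hβn
  have h₃' : Valued.v (β - α) = Valued.v ϖ ^ n₃ := by rw [Valuation.map_sub_swap, h₃]
  obtain ⟨hϖ0, hϖ1⟩ := ne_zero_and_v_lt_one_of_v_eq_exp hϖ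
  have hvϖ : 0 < Valued.v ϖ := (Valuation.pos_iff _).2 hϖ0
  obtain ⟨hi1, -, -⟩ := isoceles_depths hϖ h₁ h₂ h₃
  have hn₃ : ρ ≤ n₃ := by
    rcases min_le_iff.1 hi1 with h | h <;> omega
  have hge : Valued.v ((e 2 - e 1) / (e 2 - e 0)) = Valued.v ϖ ^ (2 * t') := v_glueRatio_eq hϖ0 hk hloc
  -- the class representatives (as a Finset) and the reference frames
  obtain ⟨R₀, hR₀fin, -, hR1, hR2, hR3⟩ := exists_fixed_class_representatives hσ hvσ hfix hϖ hd ρ t' hρ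
  set R : Finset K := hR₀fin.toFinset with hRdef
  have hmemR : ∀ g, g ∈ R ↔ g ∈ R₀ := fun g => Set.Finite.mem_toFinset hR₀fin
  have hR1' : ∀ g ∈ R, σ g = g ∧ Valued.v g = Valued.v ϖ ^ (2 * t') := fun g hg => hR1 g ((hmemR g).1 hg)
  have hR2' : ∀ f : K, σ f = f → Valued.v f = Valued.v ϖ ^ (2 * t') → ∃ g ∈ R, Valued.v (f - g) ≤ Valued.v ϖ ^ (ρ + 2 * t') :=
    fun f hσf hvf => by obtain ⟨g, hg, h⟩ := hR2 f hσf hvf; exact ⟨g, (hmemR g).2 hg, h⟩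
  have hR3' : ∀ g ∈ R, ∀ g' ∈ R, Valued.v (g - g') ≤ Valued.v ϖ ^ (ρ + 2 * t') → g = g' :=
    fun g hg g' hg' h => hR3 g ((hmemR g).1 hg) g' ((hmemR g').1 hg') h
  choose V₀ hV₀ using fun g : K => exists_gl_coe_eq_glued (1 : K) 1 g (pow_ne_zero ρ hϖ0) (pow_ne_zero (2 * ρ + 2 * t') hϖ0)
  -- the token at the reference frame `V(1,1,g)`: `κ = g`
  have hreadV : ∀ g : K, LatticeInLevel ϖ ℓ (Matrix.diagonal e) (latt (V₀ g : Matrix (Fin 3) (Fin 3) K)) ↔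
      ((Valued.v (e 0) ≤ Valued.v ϖ ^ ℓ ∧ Valued.v (e 1) ≤ Valued.v ϖ ^ ℓ ∧ Valued.v (e 2) ≤ Valued.v ϖ ^ ℓ) ∧ ℓ + ρ ≤ k) ∧
        Valued.v ϖ ^ k * Valued.v (g + (e 2 - e 1) / (e 2 - e 0)) ≤ Valued.v ϖ ^ (ℓ + 2 * ρ + 2 * t') := fun g => by
    have h := latticeInLevel_diagonal_latt_glued_iff_onLocus hϖ ℓ ρ t' k ht' e hk hloc (x := 1) (ζ := 1) (map_one _) (map_one _) g
    rw [show g / ((1 : K) * 1) = g by rw [mul_one, div_one]] at h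
    rw [hV₀ g]
    exact h
  rw [stratum_G1_eq hvσ hfix hϖ T hρ (by omega : 1 ≤ 2 * t'),
    finsum_kappaCount_mul_stabiliserWeight_glued_sep_eq hσ hvσ hfix hϖ hd hTr T hT ρ t' hρ ht' R hR1' hR2' hR3' V₀ hV₀ i
      (fun M => LatticeInLevel ϖ ℓ (Matrix.diagonal e) M) (fun u _ M => latticeInLevel_mapGL_diagGLUnits_iff u ϖ ℓ e M),
    ← Nat.card_eq_fintype_card]
  by_cases hout : (Valued.v (e 0) ≤ Valued.v ϖ ^ ℓ ∧ Valued.v (e 1) ≤ Valued.v ϖ ^ ℓ ∧ Valued.v (e 2) ≤ Valued.v ϖ ^ ℓ) ∧ ℓ + ρ ≤ k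
  · rw [if_pos hout]
    have hEeq : ℓ + 2 * ρ + 2 * t' = k + (ℓ + 2 * ρ + 2 * t' - k) := by omega
    -- the filter is the token ball of exponent `E`, i.e. the sub-ball around the fixed witness `f₀`
    have hnear : ∀ g : K, Valued.v (g + (e 2 - e 1) / (e 2 - e 0)) ≤ Valued.v ϖ ^ (ℓ + 2 * ρ + 2 * t' - k) ↔
        Valued.v (g - f₀) ≤ Valued.v ϖ ^ (ℓ + 2 * ρ + 2 * t' - k) := fun g => by
      constructor
      · intro h
        rw [show g - f₀ = (g + (e 2 - e 1) / (e 2 - e 0)) - (f₀ + (e 2 - e 1) / (e 2 - e 0)) by ring]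
        exact Valuation.map_sub_le _ h hf₀
      · intro h
        rw [show g + (e 2 - e 1) / (e 2 - e 0) = (g - f₀) + (f₀ + (e 2 - e 1) / (e 2 - e 0)) by ring]
        exact Valuation.map_add_le _ h hf₀
    have hfilter : R.filter (fun g => mapGL T (latt (V₀ g : Matrix (Fin 3) (Fin 3) K)) = latt (V₀ g : Matrix (Fin 3) (Fin 3) K) ∧
          LatticeInLevel ϖ ℓ (Matrix.diagonal e) (latt (V₀ g : Matrix (Fin 3) (Fin 3) K))) =
        R.filter (fun g => Valued.v (g - f₀) ≤ Valued.v ϖ ^ (ℓ + 2 * ρ + 2 * t' - k)) := by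
      refine Finset.filter_congr fun g hg => ?_
      rw [hreadV g, ← hnear g, hEeq, pow_mul_le_pow_add_iff hϖ0, Nat.add_sub_cancel_left]
      exact ⟨fun h => h.2.2, fun h => ⟨mapGL_latt_glued_rep_of_depths hϖ0 hϖ1.le hα hβ T hT h₁ h₂ h₃' htube.1 htube.2 hn₃ (hR1' g hg).2 (V₀ g) (hV₀ g),
        hout, h⟩⟩
    -- `|f₀| = |ϖ|^{2t′}`
    have hlt : Valued.v ϖ ^ (ℓ + 2 * ρ + 2 * t' - k) < Valued.v ϖ ^ (2 * t') := pow_lt_pow_right_of_lt_one₀ hvϖ hϖ1 (by omega)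
    have hvf₀ : Valued.v f₀ = Valued.v ϖ ^ (2 * t') := by
      have h := Valuation.map_sub_eq_of_lt_left Valued.v
        (hge ▸ (by rw [show (e 2 - e 1) / (e 2 - e 0) - (-f₀) = f₀ + (e 2 - e 1) / (e 2 - e 0) by ring]; exact hf₀.trans_lt hlt) :
          Valued.v ((e 2 - e 1) / (e 2 - e 0) - (-f₀)) < Valued.v ((e 2 - e 1) / (e 2 - e 0)))
      rw [show (e 2 - e 1) / (e 2 - e 0) - ((e 2 - e 1) / (e 2 - e 0) - -f₀) = -f₀ by ring, Valuation.map_neg] at h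
      rw [h, hge]
    -- the sub-ball system
    set S : Finset K := R.filter (fun g => Valued.v (g - f₀) ≤ Valued.v ϖ ^ (ℓ + 2 * ρ + 2 * t' - k)) with hS
    have hS1 : ∀ g ∈ S, g ∈ {g : K | σ g = g ∧ Valued.v (g - f₀) ≤ Valued.v ϖ ^ (ℓ + 2 * ρ + 2 * t' - k)} := fun g hg => by
      obtain ⟨hgR, hge'⟩ := Finset.mem_filter.1 hg
      exact ⟨(hR1' g hgR).1, hge'⟩
    have hS2 : ∀ f ∈ {g : K | σ g = g ∧ Valued.v (g - f₀) ≤ Valued.v ϖ ^ (ℓ + 2 * ρ + 2 * t' - k)},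
        ∃ g ∈ S, Valued.v (f - g) ≤ Valued.v ϖ ^ (ρ + 2 * t') := by
      intro f hf
      obtain ⟨hσf, hvf⟩ := level_of_mem_subBall hD (by omega) hvf₀ hf
      obtain ⟨g, hg, hfg⟩ := hR2' f hσf hvf
      refine ⟨g, Finset.mem_filter.2 ⟨hg, ?_⟩, hfg⟩
      rw [show g - f₀ = (f - f₀) - (f - g) by ring]
      exact Valuation.map_sub_le _ hf.2 (hfg.trans (pow_le_pow_right_of_le_one' hϖ1.le (by omega)))
    have hS3 : ∀ g ∈ S, ∀ g' ∈ S, Valued.v (g - g') ≤ Valued.v ϖ ^ (ρ + 2 * t') → g = g' :=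
      fun g hg g' hg' h => hR3' g (Finset.mem_filter.1 hg).1 g' (Finset.mem_filter.1 hg').1 h
    rw [hfilter, sum_kappaCount_glued_rep_subBall hD h2 hρ ht' (by omega) (by omega) hσf₀ hvf₀ S hS1 hS2 hS3 V₀ hV₀ i,
      ← mul_comm ((Nat.card 𝓀[K] : ℚ) ^ _), ← mul_assoc, ← pow_add,
      show 2 * ρ + 2 * t' - (ρ + 2 * t' + 1) / 2 + ((ρ + 2 * t' + 1) / 2 - (ℓ + 2 * ρ + 2 * t' - k + 1) / 2) =
        2 * ρ + 2 * t' - (ℓ + 2 * ρ + 2 * t' - k + 1) / 2 by omega, mul_comm]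
  · rw [if_neg hout]
    have hnone : ∀ g ∈ R, ¬ (mapGL T (latt (V₀ g : Matrix (Fin 3) (Fin 3) K)) = latt (V₀ g : Matrix (Fin 3) (Fin 3) K) ∧
        LatticeInLevel ϖ ℓ (Matrix.diagonal e) (latt (V₀ g : Matrix (Fin 3) (Fin 3) K))) := fun g _ h => hout ((hreadV g).1 h.2).1
    rw [Finset.filter_false_of_mem hnone, Finset.sum_empty, mul_zero]

omit [CompleteSpace K] in
/-- **HEAD — LABELLED κ-WEIGHTED G1 SUM ON THE LOCUS, GENUINE REGIME, NO FIXED WITNESS** (ANY regime of the datum): if no `σ`-fixed `f` has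
`|f + g_e| ≤ |ϖ|^{ℓ+2ρ+2t′−k}` (`k < ℓ + 2ρ`), the label-cut κ-sum vanishes (the representatives are fixed; ENGINE with the empty filter).
[cite: Kottwitz1986BaseChangeUnits, §1 pp. 240–241] [cite: LanglandsShelstad1987, §3] -/
theorem finsum_kappaCount_mul_stabiliserWeight_stratum_G1_sep_onLocus_of_no_witness (hD : IsRamifiedQuadraticDatum σ ϖ d t) (h2 : Valued.v (2 : K) < 1)
    (hT : (T : Matrix (Fin 3) (Fin 3) K) = Matrix.diagonal ![α, β, 1])
    (ρ t' : ℕ) (hρ : 1 ≤ ρ) (ht' : 1 ≤ t') (i : Fin 3) (ℓ k : ℕ) (e : Fin 3 → K)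
    (hk : Valued.v (e 2 - e 0) = Valued.v ϖ ^ k) (hloc : Valued.v (e 2 - e 1) = Valued.v ϖ ^ (k + 2 * t')) (hgen : k < ℓ + 2 * ρ)
    (hno : ¬ ∃ f : K, σ f = f ∧ Valued.v (f + (e 2 - e 1) / (e 2 - e 0)) ≤ Valued.v ϖ ^ (ℓ + 2 * ρ + 2 * t' - k)) :
    ∑ᶠ M ∈ {M | M ∈ stratum σ ϖ T ![2 * ρ, 2 * ρ + 2 * t', 2 * ρ + 2 * t'] ∧ LatticeInLevel ϖ ℓ (Matrix.diagonal e) M},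
        (kappaCount σ ϖ 0 i M : ℚ) * stabiliserWeight σ M = 0 := by
  classical
  have hTr := trace_bound_of_isRamifiedQuadraticDatum hD h2
  obtain ⟨hσ, hvσ, hϖ, hfix, hd, -, -⟩ := id hD
  obtain ⟨hϖ0, hϖ1⟩ := ne_zero_and_v_lt_one_of_v_eq_exp hϖ
  obtain ⟨R₀, hR₀fin, -, hR1, hR2, hR3⟩ := exists_fixed_class_representatives hσ hvσ hfix hϖ hd ρ t' hρ
  set R : Finset K := hR₀fin.toFinset with hRdef
  have hmemR : ∀ g, g ∈ R ↔ g ∈ R₀ := fun g => Set.Finite.mem_toFinset hR₀fin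
  have hR1' : ∀ g ∈ R, σ g = g ∧ Valued.v g = Valued.v ϖ ^ (2 * t') := fun g hg => hR1 g ((hmemR g).1 hg)
  have hR2' : ∀ f : K, σ f = f → Valued.v f = Valued.v ϖ ^ (2 * t') → ∃ g ∈ R, Valued.v (f - g) ≤ Valued.v ϖ ^ (ρ + 2 * t') :=
    fun f hσf hvf => by obtain ⟨g, hg, h⟩ := hR2 f hσf hvf; exact ⟨g, (hmemR g).2 hg, h⟩
  have hR3' : ∀ g ∈ R, ∀ g' ∈ R, Valued.v (g - g') ≤ Valued.v ϖ ^ (ρ + 2 * t') → g = g' :=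
    fun g hg g' hg' h => hR3 g ((hmemR g).1 hg) g' ((hmemR g').1 hg') h
  choose V₀ hV₀ using fun g : K => exists_gl_coe_eq_glued (1 : K) 1 g (pow_ne_zero ρ hϖ0) (pow_ne_zero (2 * ρ + 2 * t') hϖ0)
  have hreadV : ∀ g : K, LatticeInLevel ϖ ℓ (Matrix.diagonal e) (latt (V₀ g : Matrix (Fin 3) (Fin 3) K)) ↔
      ((Valued.v (e 0) ≤ Valued.v ϖ ^ ℓ ∧ Valued.v (e 1) ≤ Valued.v ϖ ^ ℓ ∧ Valued.v (e 2) ≤ Valued.v ϖ ^ ℓ) ∧ ℓ + ρ ≤ k) ∧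
        Valued.v ϖ ^ k * Valued.v (g + (e 2 - e 1) / (e 2 - e 0)) ≤ Valued.v ϖ ^ (ℓ + 2 * ρ + 2 * t') := fun g => by
    have h := latticeInLevel_diagonal_latt_glued_iff_onLocus hϖ ℓ ρ t' k ht' e hk hloc (x := 1) (ζ := 1) (map_one _) (map_one _) g
    rw [show g / ((1 : K) * 1) = g by rw [mul_one, div_one]] at h
    rw [hV₀ g]
    exact h
  have hEeq : ℓ + 2 * ρ + 2 * t' = k + (ℓ + 2 * ρ + 2 * t' - k) := by omega
  rw [stratum_G1_eq hvσ hfix hϖ T hρ (by omega : 1 ≤ 2 * t'),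
    finsum_kappaCount_mul_stabiliserWeight_glued_sep_eq hσ hvσ hfix hϖ hd hTr T hT ρ t' hρ ht' R hR1' hR2' hR3' V₀ hV₀ i
      (fun M => LatticeInLevel ϖ ℓ (Matrix.diagonal e) M) (fun u _ M => latticeInLevel_mapGL_diagGLUnits_iff u ϖ ℓ e M)]
  have hnone : ∀ g ∈ R, ¬ (mapGL T (latt (V₀ g : Matrix (Fin 3) (Fin 3) K)) = latt (V₀ g : Matrix (Fin 3) (Fin 3) K) ∧
      LatticeInLevel ϖ ℓ (Matrix.diagonal e) (latt (V₀ g : Matrix (Fin 3) (Fin 3) K))) := fun g hg h =>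
    hno ⟨g, (hR1' g hg).1, by
      have h2' := ((hreadV g).1 h.2).2
      rwa [hEeq, pow_mul_le_pow_add_iff hϖ0] at h2'⟩
  rw [Finset.filter_false_of_mem hnone, Finset.sum_empty, mul_zero]

end Summit.HodgeConjecture.HodgeConjecture.Cruxes.H413.F0P3cDyRamLabelledKappaGluedLocus

end
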